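import Literature.RepresentationTheory.Kovacevic2021.SU21SubmoduleLattice
import Literature.RepresentationTheory.Kovacevic2021.SU21PrincipalSeriesData
import HarnessLib

/-!
# Reducibility of Kovačević's principal-series data `V(c, 2t)`: the submodules generated by a `K`-type

Continuation of `…Kovacevic2021.SU21PrincipalSeriesData` (the datum `principalSeries c t` = Kovačević's
`V(c,2t)`: `K`-types the cone `{V_{1+p+q, 2t+3p−3q} : p, q ≥ 0}`, coefficients (b85)–(b100)) and of
`…Kovacevic2021.SU21SubmoduleLattice` (Lie submodules of a datum = arrow-closed sets of `K`-types).

Source, verbatim [Kovacevic2021, §3 Thm 3 and Remark 6, held text `paper:arxiv-1810.01752` p0007–p0008]: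
"This module can be reducible. Any other irreducible `(𝔤,K)` module `V` is a submodule, quotient or subquotient
of some `V(c,2t)`." — "Reducibility of modules `V(c,2t)` will be obtained when some product(s)
`a_{nm} d_{n+1,m+3}` or `b_{nm} c_{n+1,m-3}` are equal to `0`." — proof of Thm 3: "`K` modules of the
irreducible component of `V(c,2t)` can form a cone (if `a_{1+k,2t+3k} d_{2+k,2t+3+3k} ≠ 0` and
`b_{1+k,2t-3k} c_{2+k,2t-3-3k} ≠ 0` for `k ≥ 0`), a strip (if `a … d … = 0` for some `k` or `b … c … = 0` for
some `k`) or a parallelogram (if … and …)."  With (b85)–(b100): `a_{1+p+q,2t+3p−3q} = 2c−(p+1)t−p(p+2)`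
depends on the column `p` only, `b_{1+p+q,2t+3p−3q} = 2c+(q+1)t−q(q+2)` on the row `q` only,
`c = (q+1)/(n+1)`, `d = (p+1)/(n+1)` never vanish inside the cone.

## What is defined and proved

* `PrincipalSeries.acoef c t p = 2c − (p+1)t − p(p+2)` and `PrincipalSeries.bcoef c t q = 2c + (q+1)t − q(q+2)`
  (the numerators (b85)/(b90), two one-line abbreviations) and the **live arrows of `V(c,2t)`**
  (`principalSeries_A_ne_zero_iff` …): at the `K`-type `(p,q)` the arrow `A` (to `(p+1,q)`) is live iff
  `acoef c t p ≠ 0`, `B` (to `(p,q+1)`) iff `bcoef c t q ≠ 0`, `C` (to `(p,q−1)`) iff `q ≥ 1`, `D` (to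
  `(p−1,q)`) iff `p ≥ 1`.
* **Moves** (`principalSeries_vec_one_mem_down_p/q`, `…_up_p/q`): a Lie submodule containing `u^1_{(p,q)}`
  contains every `u^1_{(p',q')}` with `p' ≤ p`, `q' ≤ q` (down-moves are always live), and `u^1_{(p+d,q)}` as long
  as no root of `acoef` is crossed (`acoef c t r ≠ 0` for `p ≤ r < p+d`); similarly in `q`.
* **The submodule generated by one `K`-type** (`principalSeries_vec_mem_lieSpan_iff`): `u^1_{(p,q)}` lies in the
  Lie span of `u^1_{(p₀,q₀)}` iff `acoef c t` has no root `r` with `p₀ ≤ r < p` and `bcoef c t` no root `s` with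
  `q₀ ≤ s < q` — the cone / strip / parallelogram of the printed proof, for every starting `K`-type.
* **Irreducibility criterion** (`principalSeries_isIrreducible_iff`): `V(c,2t)` is an irreducible
  `𝔤𝔩(3,ℂ)`-module iff `acoef c t` and `bcoef c t` have no root in `ℕ`, i.e. iff
  `2c ∉ {(p+1)t + p(p+2) : p ≥ 0} ∪ {q(q+2) − (q+1)t : q ≥ 0}`.

The cohomological points `(c,t) = (0,0), (−3/2, ±3)` (parabola `6c + t² = 0`), where the roots cut the cone
into the `K`-type sets of the six modules `J_{0,0}, J_{1,0}, J_{0,1}, D_0, D_1, D_2` [BorelWallach2000, VI 4.10 (10)],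
are treated in the sequel `SU21PrincipalSeriesCohomologicalPoints`.

## References

* D. Kovačević, *Unitary `(𝔤,K)` modules of `SU(2,1)`*, Acta Math. Spalatensia 1 (2021) 105–125
  (arXiv:1810.01752): §3 Thm 3 with its proof, (b75)–(b100), Remark 6; §4 (reducibility points `c(t)`, `c(l,t)`).
  [Kovacevic2021]
-/

noncomputable section

open Finsupp

namespace Literature.RepresentationTheory.Kovacevic2021

-- Mathlib idiom (Mathlib/Algebra/Lie/OfAssociative.lean): commutator brackets on associative algebras.
attribute [local instance 100] LieRing.ofAssociativeRing

namespace SU21Datum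

namespace PrincipalSeries

/-- `a(p) = 2c − (p+1)t − p(p+2)`: the numerator of the up-arrow coefficient `A_{n,m} = a_{nm}/n` of `V(c,2t)` on the
whole column `p` (`a_{1+p+q,2t+3p−3q}`, independent of `q`). [cite: Kovacevic2021, §3 Thm 3 (b85)] -/
def acoef (c : ℂ) (t p : ℤ) : ℂ := 2 * c - ((p : ℂ) + 1) * t - (p : ℂ) * ((p : ℂ) + 2)

/-- `b(q) = 2c + (q+1)t − q(q+2)`: the numerator of the arrow coefficient `B_{n,m} = b_{nm}/n` of `V(c,2t)` on the
whole row `q` (`b_{1+p+q,2t+3p−3q}`, independent of `p`). [cite: Kovacevic2021, §3 Thm 3 (b90)] -/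
def bcoef (c : ℂ) (t q : ℤ) : ℂ := 2 * c + ((q : ℂ) + 1) * t - (q : ℂ) * ((q : ℂ) + 2)

/-- `1 + p + q ≠ 0` in `ℂ` for `p, q ≥ 0` [folklore] -/
private theorem npq_ne_zero' {p q : ℤ} (hp : 0 ≤ p) (hq : 0 ≤ q) : (1 + (p : ℂ) + q) ≠ 0 := by
  exact_mod_cast (show (1 + p + q : ℤ) ≠ 0 by omega)

/-- the coordinates `(p,q)` of a `K`-type of the cone are determined by `(n,m)` [cite: Kovacevic2021, §3 proof of Thm 3] -/
theorem coords_unique {t p q p' q' : ℤ} (hn : 1 + p + q = 1 + p' + q')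
    (hm : 2 * t + 3 * p - 3 * q = 2 * t + 3 * p' - 3 * q') : p = p' ∧ q = q' := by
  omega

end PrincipalSeries

open PrincipalSeries

section LiveArrows

variable (c : ℂ) (t : ℤ)

/-! ## §1 The live arrows of `V(c, 2t)` -/

/-- `A_{(p,q)} = a(p)/n` [cite: Kovacevic2021, §3 Thm 3 (b85)] -/
theorem principalSeries_A_eq {p q : ℤ} (hp : 0 ≤ p) (hq : 0 ≤ q) :
    (principalSeries c t).A (1 + p + q) (2 * t + 3 * p - 3 * q) = acoef c t p / (1 + (p : ℂ) + q) := by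
  show coefA c t _ _ = _
  rw [coefA_eq hp hq rfl rfl, acoef]
  push_cast
  rfl

/-- `B_{(p,q)} = b(q)/n` [cite: Kovacevic2021, §3 Thm 3 (b90)] -/
theorem principalSeries_B_eq {p q : ℤ} (hp : 0 ≤ p) (hq : 0 ≤ q) :
    (principalSeries c t).B (1 + p + q) (2 * t + 3 * p - 3 * q) = bcoef c t q / (1 + (p : ℂ) + q) := by
  show coefB c t _ _ = _
  rw [coefB_eq hp hq rfl rfl, bcoef]
  push_cast
  rfl

/-- `C_{(p,q)} = q/n` [cite: Kovacevic2021, §3 Thm 3 (b95)] -/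
theorem principalSeries_C_eq {p q : ℤ} (hp : 0 ≤ p) (hq : 0 ≤ q) :
    (principalSeries c t).C (1 + p + q) (2 * t + 3 * p - 3 * q) = (q : ℂ) / (1 + (p : ℂ) + q) := by
  show coefC t _ _ = _
  rw [coefC_eq hp hq rfl rfl]
  push_cast
  rfl

/-- `D_{(p,q)} = p/n` [cite: Kovacevic2021, §3 Thm 3 (b100)] -/
theorem principalSeries_D_eq {p q : ℤ} (hp : 0 ≤ p) (hq : 0 ≤ q) :
    (principalSeries c t).D (1 + p + q) (2 * t + 3 * p - 3 * q) = (p : ℂ) / (1 + (p : ℂ) + q) := by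
  show coefD t _ _ = _
  rw [coefD_eq hp hq rfl rfl]
  push_cast
  rfl

/-- **The arrow `A : (p,q) → (p+1,q)` of `V(c,2t)` is live iff `a(p) ≠ 0`.** [cite: Kovacevic2021, §3 Thm 3 (b85), Remark 6] -/
theorem principalSeries_A_ne_zero_iff {p q : ℤ} (hp : 0 ≤ p) (hq : 0 ≤ q) :
    (principalSeries c t).A (1 + p + q) (2 * t + 3 * p - 3 * q) ≠ 0 ↔ acoef c t p ≠ 0 := by
  rw [principalSeries_A_eq c t hp hq, div_ne_zero_iff, and_iff_left (npq_ne_zero' hp hq)]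

/-- **The arrow `B : (p,q) → (p,q+1)` is live iff `b(q) ≠ 0`.** [cite: Kovacevic2021, §3 Thm 3 (b90), Remark 6] -/
theorem principalSeries_B_ne_zero_iff {p q : ℤ} (hp : 0 ≤ p) (hq : 0 ≤ q) :
    (principalSeries c t).B (1 + p + q) (2 * t + 3 * p - 3 * q) ≠ 0 ↔ bcoef c t q ≠ 0 := by
  rw [principalSeries_B_eq c t hp hq, div_ne_zero_iff, and_iff_left (npq_ne_zero' hp hq)]

/-- **The arrow `C : (p,q) → (p,q−1)` is live iff `q ≥ 1`** (never on the edge `q = 0`, always inside).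
[cite: Kovacevic2021, §3 Thm 3 (b95)] -/
theorem principalSeries_C_ne_zero_iff {p q : ℤ} (hp : 0 ≤ p) (hq : 0 ≤ q) :
    (principalSeries c t).C (1 + p + q) (2 * t + 3 * p - 3 * q) ≠ 0 ↔ q ≠ 0 := by
  rw [principalSeries_C_eq c t hp hq, div_ne_zero_iff, and_iff_left (npq_ne_zero' hp hq), Int.cast_ne_zero]

/-- **The arrow `D : (p,q) → (p−1,q)` is live iff `p ≥ 1`.** [cite: Kovacevic2021, §3 Thm 3 (b100)] -/
theorem principalSeries_D_ne_zero_iff {p q : ℤ} (hp : 0 ≤ p) (hq : 0 ≤ q) :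
    (principalSeries c t).D (1 + p + q) (2 * t + 3 * p - 3 * q) ≠ 0 ↔ p ≠ 0 := by
  rw [principalSeries_D_eq c t hp hq, div_ne_zero_iff, and_iff_left (npq_ne_zero' hp hq), Int.cast_ne_zero]

end LiveArrows

/-! ## §2 Moves inside a Lie submodule of `V(c, 2t)` -/

section Moves

variable {c : ℂ} {t : ℤ} (N : LieSubmodule ℂ (Matrix (Fin 3) (Fin 3) ℂ) (principalSeries c t).V)

/-- one step down in `p` (arrow `D`, always live for `p+1 ≥ 1`) [cite: Kovacevic2021, §3 Thm 3 (b100), Remark 6] -/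
theorem principalSeries_vec_one_mem_pred_p {p q : ℤ} (hp : 0 ≤ p) (hq : 0 ≤ q)
    (h : (principalSeries c t).vec (1 + (p + 1) + q) (2 * t + 3 * (p + 1) - 3 * q) 1 ∈ N) :
    (principalSeries c t).vec (1 + p + q) (2 * t + 3 * p - 3 * q) 1 ∈ N := by
  have hD := (principalSeries_D_ne_zero_iff c t (p := p + 1) (q := q) (by omega) hq).2 (by omega)
  have h' := vec_one_mem_of_D_ne_zero N h hD
  convert h' using 2 <;> omega

/-- one step down in `q` (arrow `C`, always live for `q+1 ≥ 1`) [cite: Kovacevic2021, §3 Thm 3 (b95), Remark 6] -/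
theorem principalSeries_vec_one_mem_pred_q {p q : ℤ} (hp : 0 ≤ p) (hq : 0 ≤ q)
    (h : (principalSeries c t).vec (1 + p + (q + 1)) (2 * t + 3 * p - 3 * (q + 1)) 1 ∈ N) :
    (principalSeries c t).vec (1 + p + q) (2 * t + 3 * p - 3 * q) 1 ∈ N := by
  have hC := (principalSeries_C_ne_zero_iff c t (p := p) (q := q + 1) hp (by omega)).2 (by omega)
  have h' := vec_one_mem_of_C_ne_zero N h hC
  convert h' using 2 <;> omega

/-- one step up in `p` across a live `A`-arrow [cite: Kovacevic2021, §3 Thm 3 (b85), Remark 6] -/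
theorem principalSeries_vec_one_mem_succ_p {p q : ℤ} (hp : 0 ≤ p) (hq : 0 ≤ q)
    (h : (principalSeries c t).vec (1 + p + q) (2 * t + 3 * p - 3 * q) 1 ∈ N) (ha : acoef c t p ≠ 0) :
    (principalSeries c t).vec (1 + (p + 1) + q) (2 * t + 3 * (p + 1) - 3 * q) 1 ∈ N := by
  have hA := (principalSeries_A_ne_zero_iff c t hp hq).2 ha
  have h' := vec_one_mem_of_A_ne_zero N h hA
  convert h' using 2 <;> omega

/-- one step up in `q` across a live `B`-arrow [cite: Kovacevic2021, §3 Thm 3 (b90), Remark 6] -/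
theorem principalSeries_vec_one_mem_succ_q {p q : ℤ} (hp : 0 ≤ p) (hq : 0 ≤ q)
    (h : (principalSeries c t).vec (1 + p + q) (2 * t + 3 * p - 3 * q) 1 ∈ N) (hb : bcoef c t q ≠ 0) :
    (principalSeries c t).vec (1 + p + (q + 1)) (2 * t + 3 * p - 3 * (q + 1)) 1 ∈ N := by
  have hB := (principalSeries_B_ne_zero_iff c t hp hq).2 hb
  have h' := vec_one_mem_of_B_ne_zero N h hB
  convert h' using 2 <;> omega

/-- **Down-moves in `p` are free**: `u^1_{(p+d,q)} ∈ N ⇒ u^1_{(p,q)} ∈ N`. [cite: Kovacevic2021, §3 Thm 3, Remark 6] -/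
theorem principalSeries_vec_one_mem_down_p {p q : ℤ} (hp : 0 ≤ p) (hq : 0 ≤ q) (d : ℕ)
    (h : (principalSeries c t).vec (1 + (p + d) + q) (2 * t + 3 * (p + d) - 3 * q) 1 ∈ N) :
    (principalSeries c t).vec (1 + p + q) (2 * t + 3 * p - 3 * q) 1 ∈ N := by
  induction d generalizing p with
  | zero => simpa using h
  | succ d ih =>
    have h' : (principalSeries c t).vec (1 + (p + d + 1) + q) (2 * t + 3 * (p + d + 1) - 3 * q) 1 ∈ N := by
      convert h using 2 <;> push_cast <;> omega
    exact ih hp (principalSeries_vec_one_mem_pred_p N (by positivity) hq h')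

/-- **Down-moves in `q` are free**: `u^1_{(p,q+d)} ∈ N ⇒ u^1_{(p,q)} ∈ N`. [cite: Kovacevic2021, §3 Thm 3, Remark 6] -/
theorem principalSeries_vec_one_mem_down_q {p q : ℤ} (hp : 0 ≤ p) (hq : 0 ≤ q) (d : ℕ)
    (h : (principalSeries c t).vec (1 + p + (q + d)) (2 * t + 3 * p - 3 * (q + d)) 1 ∈ N) :
    (principalSeries c t).vec (1 + p + q) (2 * t + 3 * p - 3 * q) 1 ∈ N := by
  induction d generalizing q with
  | zero => simpa using h
  | succ d ih =>
    have h' : (principalSeries c t).vec (1 + p + (q + d + 1)) (2 * t + 3 * p - 3 * (q + d + 1)) 1 ∈ N := by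
      convert h using 2 <;> push_cast <;> omega
    exact ih hq (principalSeries_vec_one_mem_pred_q N hp (by positivity) h')

/-- **Up-moves in `p` until a root of `a`**: `u^1_{(p,q)} ∈ N` and `a(r) ≠ 0` for `p ≤ r < p+d` ⇒ `u^1_{(p+d,q)} ∈ N`.
[cite: Kovacevic2021, §3 Thm 3, Remark 6] -/
theorem principalSeries_vec_one_mem_up_p {p q : ℤ} (hp : 0 ≤ p) (hq : 0 ≤ q) (d : ℕ)
    (h : (principalSeries c t).vec (1 + p + q) (2 * t + 3 * p - 3 * q) 1 ∈ N)
    (ha : ∀ r : ℤ, p ≤ r → r < p + d → acoef c t r ≠ 0) :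
    (principalSeries c t).vec (1 + (p + d) + q) (2 * t + 3 * (p + d) - 3 * q) 1 ∈ N := by
  induction d with
  | zero => simpa using h
  | succ d ih =>
    have h' := ih fun r hr hrd => ha r hr (by push_cast; omega)
    have := principalSeries_vec_one_mem_succ_p N (p := p + d) (by positivity) hq h' (ha _ (by omega) (by push_cast; omega))
    convert this using 2 <;> push_cast <;> omega

/-- **Up-moves in `q` until a root of `b`**: `u^1_{(p,q)} ∈ N` and `b(s) ≠ 0` for `q ≤ s < q+d` ⇒ `u^1_{(p,q+d)} ∈ N`.
[cite: Kovacevic2021, §3 Thm 3, Remark 6] -/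
theorem principalSeries_vec_one_mem_up_q {p q : ℤ} (hp : 0 ≤ p) (hq : 0 ≤ q) (d : ℕ)
    (h : (principalSeries c t).vec (1 + p + q) (2 * t + 3 * p - 3 * q) 1 ∈ N)
    (hb : ∀ s : ℤ, q ≤ s → s < q + d → bcoef c t s ≠ 0) :
    (principalSeries c t).vec (1 + p + (q + d)) (2 * t + 3 * p - 3 * (q + d)) 1 ∈ N := by
  induction d with
  | zero => simpa using h
  | succ d ih =>
    have h' := ih fun s hs hsd => hb s hs (by push_cast; omega)
    have := principalSeries_vec_one_mem_succ_q N (q := q + d) hp (by positivity) h' (hb _ (by omega) (by push_cast; omega))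
    convert this using 2 <;> push_cast <;> omega

/-- **Reachability**: if no root of `a` lies in `[p₀, p)` and no root of `b` in `[q₀, q)`, then every Lie submodule
containing `u^1_{(p₀,q₀)}` contains `u^1_{(p,q)}` (down-moves are free, up-moves cross only live arrows).
[cite: Kovacevic2021, §3 Thm 3 (proof: cone / strip / parallelogram), Remark 6] -/
theorem principalSeries_vec_one_mem_of_reach {p₀ q₀ p q : ℤ} (hp₀ : 0 ≤ p₀) (hq₀ : 0 ≤ q₀) (hp : 0 ≤ p)
    (hq : 0 ≤ q) (h₀ : (principalSeries c t).vec (1 + p₀ + q₀) (2 * t + 3 * p₀ - 3 * q₀) 1 ∈ N)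
    (ha : ∀ r : ℤ, p₀ ≤ r → r < p → acoef c t r ≠ 0) (hb : ∀ s : ℤ, q₀ ≤ s → s < q → bcoef c t s ≠ 0) :
    (principalSeries c t).vec (1 + p + q) (2 * t + 3 * p - 3 * q) 1 ∈ N := by
  -- first adjust `p` at height `q₀`
  have h₁ : (principalSeries c t).vec (1 + p + q₀) (2 * t + 3 * p - 3 * q₀) 1 ∈ N := by
    rcases le_or_gt p₀ p with hle | hlt
    · obtain ⟨d, rfl⟩ : ∃ d : ℕ, p = p₀ + d := ⟨(p - p₀).toNat, by omega⟩
      exact principalSeries_vec_one_mem_up_p N hp₀ hq₀ d h₀ ha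
    · obtain ⟨d, rfl⟩ : ∃ d : ℕ, p₀ = p + d := ⟨(p₀ - p).toNat, by omega⟩
      exact principalSeries_vec_one_mem_down_p N hp hq₀ d h₀
  -- then adjust `q`
  rcases le_or_gt q₀ q with hle | hlt
  · obtain ⟨d, rfl⟩ : ∃ d : ℕ, q = q₀ + d := ⟨(q - q₀).toNat, by omega⟩
    exact principalSeries_vec_one_mem_up_q N hp hq₀ d h₁ hb
  · obtain ⟨d, rfl⟩ : ∃ d : ℕ, q₀ = q + d := ⟨(q₀ - q).toNat, by omega⟩
    exact principalSeries_vec_one_mem_down_q N hp hq d h₁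

end Moves

/-! ## §3 The Lie submodule generated by one `K`-type, and the irreducibility criterion -/

section Span

variable (c : ℂ) (t : ℤ)

/-- The set of `K`-types reachable from `(p₀,q₀)` without crossing a root is arrow-closed, hence the `K`-type set of
a Lie submodule (`SU21SubmoduleLattice.exists_lieSubmodule_eq_supported`).
[cite: Kovacevic2021, §3 Thm 3 (proof), Remark 6] -/
theorem principalSeries_exists_lieSubmodule_reach (p₀ q₀ : ℤ) :
    ∃ N : LieSubmodule ℂ (Matrix (Fin 3) (Fin 3) ℂ) (principalSeries c t).V,
      (N : Submodule ℂ (principalSeries c t).V) = Finsupp.supported ℂ ℂ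
        {x : (principalSeries c t).Idx | (x.1.1, x.1.2.1) ∈ {y : ℤ × ℤ | ∃ p q : ℤ, 0 ≤ p ∧ 0 ≤ q ∧
          y = (1 + p + q, 2 * t + 3 * p - 3 * q) ∧ (∀ r : ℤ, p₀ ≤ r → r < p → acoef c t r ≠ 0) ∧
          (∀ s : ℤ, q₀ ≤ s → s < q → bcoef c t s ≠ 0)}} := by
  refine exists_lieSubmodule_eq_supported ?_ ?_ ?_ ?_
  · rintro n m ⟨p, q, hp, hq, ⟨rfl, rfl⟩, ha, hb⟩ hA -
    refine ⟨p + 1, q, by omega, hq, Prod.ext (by push_cast; ring) (by push_cast; ring), fun r hr hrp => ?_, hb⟩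
    rcases lt_or_eq_of_le (Int.lt_add_one_iff.1 hrp) with h | rfl
    · exact ha r hr h
    · exact (principalSeries_A_ne_zero_iff c t hp hq).1 hA
  · rintro n m ⟨p, q, hp, hq, ⟨rfl, rfl⟩, ha, hb⟩ hB -
    refine ⟨p, q + 1, hp, by omega, Prod.ext (by push_cast; ring) (by push_cast; ring), ha, fun s hs hsq => ?_⟩
    rcases lt_or_eq_of_le (Int.lt_add_one_iff.1 hsq) with h | rfl
    · exact hb s hs h
    · exact (principalSeries_B_ne_zero_iff c t hp hq).1 hB
  · rintro n m ⟨p, q, hp, hq, ⟨rfl, rfl⟩, ha, hb⟩ hC -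
    have hq1 : q ≠ 0 := (principalSeries_C_ne_zero_iff c t hp hq).1 hC
    exact ⟨p, q - 1, hp, by omega, Prod.ext (by push_cast; ring) (by push_cast; ring), ha,
      fun s hs hsq => hb s hs (by omega)⟩
  · rintro n m ⟨p, q, hp, hq, ⟨rfl, rfl⟩, ha, hb⟩ hD -
    have hp1 : p ≠ 0 := (principalSeries_D_ne_zero_iff c t hp hq).1 hD
    exact ⟨p - 1, q, by omega, hq, Prod.ext (by push_cast; ring) (by push_cast; ring),
      fun r hr hrp => ha r hr (by omega), hb⟩

/-- **The Lie submodule of `V(c,2t)` generated by the `K`-type `(p₀,q₀)`**: `u^1_{(p,q)}` lies in the Lie span of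
`u^1_{(p₀,q₀)}` iff `a` has no root `r` with `p₀ ≤ r < p` and `b` no root `s` with `q₀ ≤ s < q` (a cone if no root
lies above/right of `(p₀,q₀)`, a strip if one family of roots does, a parallelogram if both do).
[cite: Kovacevic2021, §3 Thm 3 (proof: cone / strip / parallelogram), Remark 6] -/
theorem principalSeries_vec_mem_lieSpan_iff {p₀ q₀ p q : ℤ} (hp₀ : 0 ≤ p₀) (hq₀ : 0 ≤ q₀) (hp : 0 ≤ p)
    (hq : 0 ≤ q) :
    (principalSeries c t).vec (1 + p + q) (2 * t + 3 * p - 3 * q) 1 ∈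
        LieSubmodule.lieSpan ℂ (Matrix (Fin 3) (Fin 3) ℂ)
          {(principalSeries c t).vec (1 + p₀ + q₀) (2 * t + 3 * p₀ - 3 * q₀) 1} ↔
      (∀ r : ℤ, p₀ ≤ r → r < p → acoef c t r ≠ 0) ∧ (∀ s : ℤ, q₀ ≤ s → s < q → bcoef c t s ≠ 0) := by
  constructor
  · intro hmem
    obtain ⟨N, hN⟩ := principalSeries_exists_lieSubmodule_reach c t p₀ q₀
    have h₀ : (principalSeries c t).vec (1 + p₀ + q₀) (2 * t + 3 * p₀ - 3 * q₀) 1 ∈ N := by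
      rw [← LieSubmodule.mem_toSubmodule, hN, vec_mem_supported_iff ⟨mem_cone hp₀ hq₀ rfl rfl, le_rfl,
        by omega⟩]
      exact ⟨p₀, q₀, hp₀, hq₀, rfl, fun r hr hrp => absurd hrp (not_lt.2 hr), fun s hs hsq => absurd hsq (not_lt.2 hs)⟩
    have hle : LieSubmodule.lieSpan ℂ (Matrix (Fin 3) (Fin 3) ℂ)
        {(principalSeries c t).vec (1 + p₀ + q₀) (2 * t + 3 * p₀ - 3 * q₀) 1} ≤ N := by
      rw [LieSubmodule.lieSpan_le]
      rintro _ rfl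
      exact h₀
    have hmem' := hle hmem
    rw [← LieSubmodule.mem_toSubmodule, hN, vec_mem_supported_iff ⟨mem_cone hp hq rfl rfl, le_rfl, by omega⟩]
      at hmem'
    obtain ⟨p', q', -, -, hpq, ha, hb⟩ := hmem'
    obtain ⟨rfl, rfl⟩ := coords_unique (Prod.mk.inj hpq).1 (Prod.mk.inj hpq).2
    exact ⟨ha, hb⟩
  · rintro ⟨ha, hb⟩
    exact principalSeries_vec_one_mem_of_reach _ hp₀ hq₀ hp hq (LieSubmodule.subset_lieSpan rfl) ha hb

/-- **Irreducibility criterion for `V(c,2t)`**: Kovačević's principal-series module is an irreducible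
`𝔤𝔩(3,ℂ)`-module iff NO arrow coefficient vanishes on the cone, i.e. iff `a(p) = 2c−(p+1)t−p(p+2) ≠ 0` for all
`p ≥ 0` and `b(q) = 2c+(q+1)t−q(q+2) ≠ 0` for all `q ≥ 0`; otherwise the vertex generates a proper submodule
(a strip or a parallelogram). [cite: Kovacevic2021, §3 Thm 3 and Remark 6; §4 (`V(c,0)` reducible at `c = c(0) = 0`)] -/
theorem principalSeries_isIrreducible_iff :
    LieModule.IsIrreducible ℂ (Matrix (Fin 3) (Fin 3) ℂ) (principalSeries c t).V ↔
      (∀ p : ℤ, 0 ≤ p → acoef c t p ≠ 0) ∧ (∀ q : ℤ, 0 ≤ q → bcoef c t q ≠ 0) := by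
  constructor
  · intro hirr
    -- the vertex generates everything
    have htop : LieSubmodule.lieSpan ℂ (Matrix (Fin 3) (Fin 3) ℂ)
        {(principalSeries c t).vec (1 + 0 + 0) (2 * t + 3 * 0 - 3 * 0) 1} = ⊤ := by
      haveI := hirr
      rcases IsSimpleOrder.eq_bot_or_eq_top (LieSubmodule.lieSpan ℂ (Matrix (Fin 3) (Fin 3) ℂ)
        {(principalSeries c t).vec (1 + 0 + 0) (2 * t + 3 * 0 - 3 * 0) 1}) with h | h
      · exfalso
        have hv : (principalSeries c t).vec (1 + 0 + 0) (2 * t + 3 * 0 - 3 * 0) 1 ∈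
            LieSubmodule.lieSpan ℂ (Matrix (Fin 3) (Fin 3) ℂ)
              {(principalSeries c t).vec (1 + 0 + 0) (2 * t + 3 * 0 - 3 * 0) 1} :=
          LieSubmodule.subset_lieSpan rfl
        rw [h, LieSubmodule.mem_bot] at hv
        exact vec_ne_zero ⟨mem_cone le_rfl le_rfl rfl rfl, le_rfl, by norm_num⟩ hv
      · exact h
    have hall : ∀ p q : ℤ, 0 ≤ p → 0 ≤ q →
        (∀ r : ℤ, 0 ≤ r → r < p → acoef c t r ≠ 0) ∧ (∀ s : ℤ, 0 ≤ s → s < q → bcoef c t s ≠ 0) := by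
      intro p q hp hq
      rw [← principalSeries_vec_mem_lieSpan_iff c t le_rfl le_rfl hp hq, htop]
      exact LieSubmodule.mem_top _
    exact ⟨fun p hp => (hall (p + 1) 0 (by omega) le_rfl).1 p hp (by omega),
      fun q hq => (hall 0 (q + 1) le_rfl (by omega)).2 q hq (by omega)⟩
  · rintro ⟨ha, hb⟩
    refine isIrreducible_of_connected (vertex_mem c t) fun N n m hS h1 n' m' hS' => ?_
    obtain ⟨p₀, q₀, hp₀, hq₀, rfl, rfl⟩ := (mem_principalSeries_S_iff c t n m).1 hS
    obtain ⟨p, q, hp, hq, rfl, rfl⟩ := (mem_principalSeries_S_iff c t n' m').1 hS'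
    exact principalSeries_vec_one_mem_of_reach N hp₀ hq₀ hp hq h1 (fun r hr _ => ha r (by omega))
      (fun s hs _ => hb s (by omega))

/-- In particular `V(c,2t)` is REDUCIBLE as soon as one `a(p)` (`p ≥ 0`) vanishes: the columns `≤ p` span a proper
submodule (a "strip"). [cite: Kovacevic2021, §3 proof of Thm 3, Remark 6] -/
theorem principalSeries_not_isIrreducible_of_acoef_eq_zero {p : ℤ} (hp : 0 ≤ p) (ha : acoef c t p = 0) :
    ¬ LieModule.IsIrreducible ℂ (Matrix (Fin 3) (Fin 3) ℂ) (principalSeries c t).V := fun h =>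
  ((principalSeries_isIrreducible_iff c t).1 h).1 p hp ha

/-- … and as soon as one `b(q)` (`q ≥ 0`) vanishes (the rows `≤ q` span a proper submodule).
[cite: Kovacevic2021, §3 proof of Thm 3, Remark 6] -/
theorem principalSeries_not_isIrreducible_of_bcoef_eq_zero {q : ℤ} (hq : 0 ≤ q) (hb : bcoef c t q = 0) :
    ¬ LieModule.IsIrreducible ℂ (Matrix (Fin 3) (Fin 3) ℂ) (principalSeries c t).V := fun h =>
  ((principalSeries_isIrreducible_iff c t).1 h).2 q hq hb

end Span

end SU21Datum

end Literature.RepresentationTheory.Kovacevic2021
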